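import Summits.BirchSwinnertonDyer.Rank1Residual.Additive.X3BranchDegenerateCountCells
import Summits.BirchSwinnertonDyer.Rank1Residual.Additive.X3BranchCertificateRoadGord
import Summits.BirchSwinnertonDyer.Rank1Residual.Additive.X3BranchCertificateRoadMult
import Summits.BirchSwinnertonDyer.Rank1Residual.Additive.GordRankZeroChiBranch
import Summits.BirchSwinnertonDyer.Rank1Residual.Additive.N10IsogenyTransport
import HarnessLib

/-!
# X3, the DEGENERATE rows (`p = 3`: `W[3]^{ss} = {1, ω}`), rank `0`: the END STATES —
# `Typed.MissingLowerBoundAt W p` and Miller's `BSD(E,p)` on X3♯(G-ord, `e = 2`) and X3♯(M) from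
# PUBLISHED records + the line datum + the finiteness of `W(ℚ_∞)[p^∞]` + ONE unit-coefficient
# certificate + ONE evaluation of the residual count (cell `bsd-eis`, seat `bsd-eis-x3` gen 2; sequel
# of `X3BranchDegenerateCount[Cells].lean` and `X3BranchCertificateRoad[Gord|Mult].lean`; route K1
# `AdditiveBranchIMC`, cruxes `GordTwoRankZeroOffCaseOne` / `MultLower` — supports only)

HONEST FRAMING (cell `bsd-eis`, `run/shared/lean/pub/bsd-eis/README.md` §4): the programme's target of
record is the full Birch–Swinnerton-Dyer formula for every `E/ℚ` of analytic rank `≤ 1`; this file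
concerns the DEGENERATE X3 rows of the semistable-twist locus at analytic rank `0` (rational `p`-line
with TRIVIAL character on the ramified ordinary line of the twisted datum — no Case-1 member in
bsd-addord's sense; 8 901 classes at `p = 3` in bsd-addord's branch-parity census, 4 068 all-rank-0).
THEOREMS ONLY (no `def`, no named fact, no `sorry`); nothing is booked; no label, tier or count of
record moves. The road composed here: the degenerate COUNT (`X3BranchDegenerateCountCells.lean`:
`p^{λ(g)+Σδ+1} = #H¹(ℚ_Σ/ℚ_∞, Φ₀)·#U`, from `h23`, `hRQ`, `hGrK` / `hT40`+`hT41`, `hLiftE` + `hA`)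
⟹ with the displayed EVALUATION `hn` the algebraic `λ = n` (`hLamW`) ⟹ with the per-pair
unit-coefficient CERTIFICATE `hcert` and Wuthrich's Thm. 16 the `W`-level branch main conjecture and
the `T = 0` lower inputs (`X3BranchCertificateRoad[Gord|Mult].lean`) ⟹ the rank-`0` end states
through the PUBLISHED records `hDelG` / `hDelX`, `hDel98`, `hPal`, `hGZK`, `hmod`, `hmodD`. DISPLAYED
per pair and NOT asserted: `hA` (`W(ℚ_∞)[p^∞]` finite: Imai 1975 / Ribet 1981, class-wide in print,
not in the tree), `hcert` (instrument), `hn` (class-field theory over `ℚ_∞` for the trivial and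
Teichmüller characters: `n = Σ_ℓ s_ℓ t_ℓ(E) − 2`, x3-MEMO-2 D3; per pair an instrument datum).

References: [Delbourgo1998] Prop. 4, Main Conjecture p. 151; [Wuthrich2014] Thm. 16; [Pal2012] Thm. 3.2;
[GreenbergVatsal2000] §2 pp. 14–30, Remark (2.7), Prop. (2.8), Remark (2.9); [GreenbergLNM1716] §3 Lemma
3.4, Props. 2.2/2.4; [SilvermanATAEC1994] V.5.3/5.4; [MazurTateTeitelbaum1986Invent] §I.13–I.14;
[Miller2011LMS] Def. 1.1; cell files `run/shared/lean/pub/bsd-eis/x3-MEMO-{1,2,3}.md`.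
-/

set_option autoImplicit false

noncomputable section

open scoped Classical AddSubgroup

namespace Summit.BirchSwinnertonDyer.Rank1Residual.Additive

open NumberField IsDedekindDomain Field WeierstrassCurve
  Literature.NumberTheory.GaloisRepresentations
  Literature.NumberTheory.EllipticCurves
  Literature.NumberTheory.EllipticCurves.GreenbergSelmer
  Literature.NumberTheory.EllipticCurves.GreenbergVatsal2000
  Literature.NumberTheory.EllipticCurves.Rank1Residual
  Summit.BirchSwinnertonDyer.Rank1Residual.X1.MuLambda
  Summit.BirchSwinnertonDyer.Rank1Residual.AdditivePotMult

/-! ### END STATES on the degenerate rows, rank `0` -/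

section EndStates

variable {p : ℕ} [hp : Fact p.Prime] {W : WeierstrassCurve ℚ} [W.IsElliptic] [W.IsGloballyMinimal]

open Literature.NumberTheory.EllipticCurves.ModularForms
  Literature.NumberTheory.EllipticCurves.Rank1Residual.Typed
  Summit.BirchSwinnertonDyer.Rank1Residual.Additive.X3Branch

/-- **X3♯(G-ord) ∩ `I₀*` ∧ `r_an = 0`, DEGENERATE rows, every odd `p`: `Typed.MissingLowerBoundAt W p`
— the currency of route K1's crux `GordTwoRankZeroOffCaseOne` on these (no-Case-1) rows — from the
PUBLISHED records `hDelG`, `hGZK`, `hmod`, `hmodD`, `hW16`, `h23`, `hRQ`, `hGrK`, `hLiftE` + the line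
datum (`Φ₀` rational with TRIVIAL `Γ_ℚ`-action; `Σ₀ ∌ p` nonempty with the bad places `≠ p` inside)
+ THREE displayed per-pair inputs: `hA` (`W(ℚ_∞)[p^∞]` finite — Imai/Ribet, class-wide in print,
not in the tree), `hcert` (ONE unit coefficient of `ϖ·B_m` at index `n`, every twist model — an
INSTRUMENT datum) and `hn` (the EVALUATION `p^{n + Σδ + 1} = #H¹(ℚ_Σ/ℚ_∞, 𝔽_p)·#U(μ_p)`, i.e.
`n = Σ_ℓ s_ℓ t_ℓ(E) − 2`). NOT a class theorem; nothing booked.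
[cite: Delbourgo1998, Prop. 4 (p. 144)] [cite: GreenbergLNM1716, §3 Lemma 3.4 (p. 89), Props. 2.2, 2.4]
[cite: Wuthrich2014, Thm. 16 (p. 397)] [cite: GreenbergVatsal2000, §2 pp. 26–30, Remark (2.7), Prop. (2.8), Remark (2.9)]
[cite: MazurTateTeitelbaum1986Invent, §I.13–I.14] [cite: Miller2011LMS, Def. 1.1] -/
theorem ClassX3Gord.missingLowerBoundAt_rankZero_degenerate_of_facts
    (hDelG : Delbourgo1998.prop4_rankZero_constantCoeff_eq_unit_mul_of_potGoodOrd)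
    (hGZK : rank_eq_analyticRank_of_analyticRank_le_one) (hmod : hasEntireLFunction_rat)
    (hmodD : nonempty_modularParametrizationData)
    (hW16 : Wuthrich2014.thm16_halfEigenCharIdeal_dvd_cyclotomicPrime)
    (h23 : datumSelmer_nonPrimitive_invariants)
    (hRQ : datumSelmer_divisible_of_finite_torsionBy_of_gr_inertiaInvariants_eq_zero)
    (hGrK : Greenberg1999.imKummer_ge_strictCondition_goodOrdinary)
    (hLiftE : residualEpsilon_surjOn_of_lineEven)
    (hX : ClassX3Gord W p) (hp2 : p ≠ 2) (he : semistabilityIndex W p = 2) (hr : W.analyticRank = 0)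
    (S₀ : Finset (HeightOneSpectrum (𝓞 ℚ))) (hne : S₀.Nonempty)
    (hS₀ : ∀ v ∈ S₀, ((p : ℕ) : 𝓞 ℚ) ∉ v.asIdeal)
    (hS : ∀ v : HeightOneSpectrum (𝓞 ℚ), v ∉ S₀ → ((p : ℕ) : 𝓞 ℚ) ∉ v.asIdeal →
      W.HasGoodReductionAt v)
    (Φ₀ : AddSubgroup (W.geomTorsion (p : ℤ))) (hΦ : IsRationalLine W p Φ₀)
    (htriv : ∀ (σ : absoluteGaloisGroup ℚ) (P : geomTorsion W (p : ℤ)), P ∈ Φ₀ → σ • P = P)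
    (hA : ∀ κ : ZpExtension ℚ p, κ.IsCyclotomic →
      Finite (FixedPoints.addSubgroup κ.kerSubgroup (W.geomPrimaryTorsion p)))
    {n : ℕ}
    (hcert : ∀ (V : WeierstrassCurve ℚ) [V.IsElliptic] [V.IsGloballyMinimal] (C : VariableChange ℚ),
      C • V.quadraticTwist ((-1) ^ (p / 2) * p : ℚ) = W → X3BranchUnitCoeffCertAt V p n)
    (hn : ∀ (κ : ZpExtension ℚ p), κ.IsCyclotomic →
      p ^ (n + ∑ v ∈ S₀, delta W p v + 1) =
        Nat.card (residualLineH1 W p κ S₀ Φ₀ hΦ) * Nat.card (residualQuotSelmer W p κ S₀ Φ₀ hΦ)) :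
    MissingLowerBoundAt W p := by
  obtain ⟨V, _, _, C, hV, hC⟩ := ClassX3Gord.exists_goodOrd_pStar_twist_model W p hp2 hX he
  exact ClassX3Gord.missingLowerBoundAt_rankZero_of_unitCoeffCert_of_lamEqW hDelG hGZK hmod hmodD hW16
    hX hp2 he hr hcert
    (fun D g hκ hγ hDt hchar hμg ↦ X3Branch.lamEqW_of_countSucc_of_eval S₀ hΦ
      (fun D' g' hκ' hγ' hDt' hg' hμ' ↦ X3Branch.algebraicCountW_degenerate_of_facts h23 hRQ hGrK hLiftE
        hp2 V hV hC S₀ hne hS₀ hS Φ₀ hΦ htriv (hA _ hκ') D' g' hκ' hγ' hDt' hg' hμ')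
      hn D g hκ hγ hDt hchar hμg)

/-- **X3♯(G-ord) ∩ `I₀*` at `p = 3`, `r_an = 0`, DEGENERATE rows (`W[3]^{ss} = {1, ω}`): Miller's
`BSD(E,3)`** from the PUBLISHED records (+ `hDel98` for the upper half) + the line datum + `hA` +
`hcert` + `hn`, through the certificate road's `ClassX3Gord.bsdp_three_rankZero_of_unitCoeffCert_of_lamEqW`.
The typed end of the DEGENERATE X3 road at `3` (8 901 classes of bsd-addord's branch-parity census):
per pair ONE modular-symbol certificate and ONE residual-count evaluation. NOT a class theorem.
[cite: Delbourgo1998, Prop. 4 (p. 144)] [cite: Wuthrich2014, Thm. 16 (p. 397)]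
[cite: GreenbergVatsal2000, §2 pp. 26–30, Remark (2.7), Remark (2.9)] [cite: Miller2011LMS, §1 and Def. 1.1] -/
theorem ClassX3Gord.bsdp_three_rankZero_degenerate_of_facts [Fact (Nat.Prime 3)]
    {W : WeierstrassCurve ℚ} [W.IsElliptic] [W.IsGloballyMinimal]
    (hDelG : Delbourgo1998.prop4_rankZero_constantCoeff_eq_unit_mul_of_potGoodOrd)
    (hDel98 : Delbourgo1998.prop4_rankZero_pow_dvd_constantCoeff)
    (hGZK : rank_eq_analyticRank_of_analyticRank_le_one) (hmod : hasEntireLFunction_rat)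
    (hmodD : nonempty_modularParametrizationData)
    (hW16 : Wuthrich2014.thm16_halfEigenCharIdeal_dvd_cyclotomicPrime)
    (h23 : datumSelmer_nonPrimitive_invariants)
    (hRQ : datumSelmer_divisible_of_finite_torsionBy_of_gr_inertiaInvariants_eq_zero)
    (hGrK : Greenberg1999.imKummer_ge_strictCondition_goodOrdinary)
    (hLiftE : residualEpsilon_surjOn_of_lineEven)
    (hX : ClassX3Gord W 3) (hr : W.analyticRank = 0)
    (S₀ : Finset (HeightOneSpectrum (𝓞 ℚ))) (hne : S₀.Nonempty)
    (hS₀ : ∀ v ∈ S₀, (((3 : ℕ) : ℕ) : 𝓞 ℚ) ∉ v.asIdeal)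
    (hS : ∀ v : HeightOneSpectrum (𝓞 ℚ), v ∉ S₀ → (((3 : ℕ) : ℕ) : 𝓞 ℚ) ∉ v.asIdeal →
      W.HasGoodReductionAt v)
    (Φ₀ : AddSubgroup (W.geomTorsion ((3 : ℕ) : ℤ))) (hΦ : IsRationalLine W 3 Φ₀)
    (htriv : ∀ (σ : absoluteGaloisGroup ℚ) (P : geomTorsion W ((3 : ℕ) : ℤ)), P ∈ Φ₀ → σ • P = P)
    (hA : ∀ κ : ZpExtension ℚ 3, κ.IsCyclotomic →
      Finite (FixedPoints.addSubgroup κ.kerSubgroup (W.geomPrimaryTorsion 3)))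
    {n : ℕ}
    (hcert : ∀ (V : WeierstrassCurve ℚ) [V.IsElliptic] [V.IsGloballyMinimal] (C : VariableChange ℚ),
      C • V.quadraticTwist ((-1) ^ ((3 : ℕ) / 2) * (3 : ℕ) : ℚ) = W → X3BranchUnitCoeffCertAt V 3 n)
    (hn : ∀ (κ : ZpExtension ℚ 3), κ.IsCyclotomic →
      3 ^ (n + ∑ v ∈ S₀, delta W 3 v + 1) =
        Nat.card (residualLineH1 W 3 κ S₀ Φ₀ hΦ) * Nat.card (residualQuotSelmer W 3 κ S₀ Φ₀ hΦ)) :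
    BSDp W 3 := by
  have he : semistabilityIndex W 3 = 2 :=
    semistabilityIndex_eq_two_of_typeG_three W hX.typeGOrd.typeG hX.addv
  obtain ⟨V, _, _, C, hV, hC⟩ := ClassX3Gord.exists_goodOrd_pStar_twist_model W 3 (by norm_num) hX he
  exact ClassX3Gord.bsdp_three_rankZero_of_unitCoeffCert_of_lamEqW hDelG hDel98 hGZK hmod hmodD hW16 hX
    hr hcert
    (fun D g hκ hγ hDt hchar hμg ↦ X3Branch.lamEqW_of_countSucc_of_eval S₀ hΦ
      (fun D' g' hκ' hγ' hDt' hg' hμ' ↦ X3Branch.algebraicCountW_degenerate_of_facts h23 hRQ hGrK hLiftE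
        (by norm_num) V hV hC S₀ hne hS₀ hS Φ₀ hΦ htriv (hA _ hκ') D' g' hκ' hγ' hDt' hg' hμ')
      hn D g hκ hγ hDt hchar hμg)

/-- **X3♯(M) ∧ `r_an = 0`, DEGENERATE rows, every odd `p`: `Typed.MissingLowerBoundAt W p`** — the
currency of route K1's crux `MultLower` on these rows — from the PUBLISHED records `hDelX`, `hPal`,
`hGZK`, `hmod`, `hmodD`, `hW16`, `h23`, `hRQ`, `hT40`, `hT41`, `hLiftE` + the line datum + `hA` +
`hcert` + `hn` (certificate road, `ClassX3M.missingLowerBoundAt_rankZero_of_unitCoeffCert_of_lamEqW`).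
NOT a class theorem; nothing booked. [cite: Delbourgo1998, Prop. 4 (p. 144)] [cite: Pal2012, Thm. 3.2]
[cite: Wuthrich2014, Thm. 16 (p. 397)] [cite: GreenbergVatsal2000, §2 pp. 14–15, 26–30, Remark (2.7), Remark (2.9)]
[cite: SilvermanATAEC1994, Ch. V Thm. 5.3, Cor. 5.4] [cite: MazurTateTeitelbaum1986Invent, §I.13–I.14] -/
theorem ClassX3M.missingLowerBoundAt_rankZero_degenerate_of_facts
    (hDelX : Delbourgo1998.prop4_rankZero_constantCoeff_eq_unit_mul_of_potMult)
    (hPal : Pal2012.thm32_sqrt_mul_realPeriodRat_twist_eq_of_prime_one_mod_four)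
    (hGZK : rank_eq_analyticRank_of_analyticRank_le_one) (hmod : hasEntireLFunction_rat)
    (hmodD : nonempty_modularParametrizationData)
    (hW16 : Wuthrich2014.thm16_halfEigenCharIdeal_dvd_cyclotomicPrime)
    (h23 : datumSelmer_nonPrimitive_invariants)
    (hRQ : datumSelmer_divisible_of_finite_torsionBy_of_gr_inertiaInvariants_eq_zero)
    (hT40 : Silverman1994_thmV53_tateUniformisation.{0})
    (hT41 : Silverman1994_thmV53_corV54_tateUniformisation.{0})
    (hLiftE : residualEpsilon_surjOn_of_lineEven)
    (hX : ClassX3M W p) (hr : W.analyticRank = 0)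
    (S₀ : Finset (HeightOneSpectrum (𝓞 ℚ))) (hne : S₀.Nonempty)
    (hS₀ : ∀ v ∈ S₀, ((p : ℕ) : 𝓞 ℚ) ∉ v.asIdeal)
    (hS : ∀ v : HeightOneSpectrum (𝓞 ℚ), v ∉ S₀ → ((p : ℕ) : 𝓞 ℚ) ∉ v.asIdeal →
      W.HasGoodReductionAt v)
    (Φ₀ : AddSubgroup (W.geomTorsion (p : ℤ))) (hΦ : IsRationalLine W p Φ₀)
    (htriv : ∀ (σ : absoluteGaloisGroup ℚ) (P : geomTorsion W (p : ℤ)), P ∈ Φ₀ → σ • P = P)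
    (hA : ∀ κ : ZpExtension ℚ p, κ.IsCyclotomic →
      Finite (FixedPoints.addSubgroup κ.kerSubgroup (W.geomPrimaryTorsion p)))
    {n : ℕ}
    (hcert : ∀ (V : WeierstrassCurve ℚ) [V.IsElliptic] [V.IsGloballyMinimal] (C : VariableChange ℚ),
      C • V.quadraticTwist ((-1) ^ (p / 2) * p : ℚ) = W → X3BranchUnitCoeffCertAt V p n)
    (hn : ∀ (κ : ZpExtension ℚ p), κ.IsCyclotomic →
      p ^ (n + ∑ v ∈ S₀, delta W p v + 1) =
        Nat.card (residualLineH1 W p κ S₀ Φ₀ hΦ) * Nat.card (residualQuotSelmer W p κ S₀ Φ₀ hΦ)) :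
    MissingLowerBoundAt W p := by
  have hp2 : p ≠ 2 := ClassX3M.p_ne_two W p hX
  obtain ⟨V, _, _, C, hmult, hC⟩ := ClassX3M.exists_mult_pStar_twist_model (W := W) (p := p) hX
  exact ClassX3M.missingLowerBoundAt_rankZero_of_unitCoeffCert_of_lamEqW hDelX hPal hGZK hmod hmodD hW16
    hX hr hcert
    (fun D g hκ hγ hDt hchar hμg ↦ X3Branch.lamEqW_of_countSucc_of_eval S₀ hΦ
      (fun D' g' hκ' hγ' hDt' hg' hμ' ↦ X3Branch.algebraicCountWMult_degenerate_of_facts h23 hRQ hT40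
        hT41 hLiftE hp2 (ClassX3M.potMult W p hX) V hmult hC S₀ hne hS₀ hS Φ₀ hΦ htriv (hA _ hκ') D' g'
        hκ' hγ' hDt' hg' hμ')
      hn D g hκ hγ hDt hchar hμg)

/-- **X3♯(M) ∧ `r_an = 0`, DEGENERATE rows, every odd `p`: Miller's `BSD(E,p)`** (+ `hDel98` for the
upper half; certificate road `ClassX3M.bsdp_rankZero_of_unitCoeffCert_of_lamEqW`). NOT a class theorem.
[cite: Delbourgo1998, Prop. 4 (p. 144), Main Conjecture p. 151] [cite: Pal2012, Thm. 3.2]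
[cite: Wuthrich2014, Thm. 16 (p. 397)] [cite: GreenbergVatsal2000, §2 pp. 14–15, 26–30, Remark (2.7), Remark (2.9)]
[cite: Miller2011LMS, §1 and Def. 1.1] -/
theorem ClassX3M.bsdp_rankZero_degenerate_of_facts
    (hDel98 : Delbourgo1998.prop4_rankZero_pow_dvd_constantCoeff)
    (hDelX : Delbourgo1998.prop4_rankZero_constantCoeff_eq_unit_mul_of_potMult)
    (hPal : Pal2012.thm32_sqrt_mul_realPeriodRat_twist_eq_of_prime_one_mod_four)
    (hGZK : rank_eq_analyticRank_of_analyticRank_le_one) (hmod : hasEntireLFunction_rat)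
    (hmodD : nonempty_modularParametrizationData)
    (hW16 : Wuthrich2014.thm16_halfEigenCharIdeal_dvd_cyclotomicPrime)
    (h23 : datumSelmer_nonPrimitive_invariants)
    (hRQ : datumSelmer_divisible_of_finite_torsionBy_of_gr_inertiaInvariants_eq_zero)
    (hT40 : Silverman1994_thmV53_tateUniformisation.{0})
    (hT41 : Silverman1994_thmV53_corV54_tateUniformisation.{0})
    (hLiftE : residualEpsilon_surjOn_of_lineEven)
    (hX : ClassX3M W p) (hr : W.analyticRank = 0)
    (S₀ : Finset (HeightOneSpectrum (𝓞 ℚ))) (hne : S₀.Nonempty)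
    (hS₀ : ∀ v ∈ S₀, ((p : ℕ) : 𝓞 ℚ) ∉ v.asIdeal)
    (hS : ∀ v : HeightOneSpectrum (𝓞 ℚ), v ∉ S₀ → ((p : ℕ) : 𝓞 ℚ) ∉ v.asIdeal →
      W.HasGoodReductionAt v)
    (Φ₀ : AddSubgroup (W.geomTorsion (p : ℤ))) (hΦ : IsRationalLine W p Φ₀)
    (htriv : ∀ (σ : absoluteGaloisGroup ℚ) (P : geomTorsion W (p : ℤ)), P ∈ Φ₀ → σ • P = P)
    (hA : ∀ κ : ZpExtension ℚ p, κ.IsCyclotomic →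
      Finite (FixedPoints.addSubgroup κ.kerSubgroup (W.geomPrimaryTorsion p)))
    {n : ℕ}
    (hcert : ∀ (V : WeierstrassCurve ℚ) [V.IsElliptic] [V.IsGloballyMinimal] (C : VariableChange ℚ),
      C • V.quadraticTwist ((-1) ^ (p / 2) * p : ℚ) = W → X3BranchUnitCoeffCertAt V p n)
    (hn : ∀ (κ : ZpExtension ℚ p), κ.IsCyclotomic →
      p ^ (n + ∑ v ∈ S₀, delta W p v + 1) =
        Nat.card (residualLineH1 W p κ S₀ Φ₀ hΦ) * Nat.card (residualQuotSelmer W p κ S₀ Φ₀ hΦ)) :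
    BSDp W p := by
  have hp2 : p ≠ 2 := ClassX3M.p_ne_two W p hX
  obtain ⟨V, _, _, C, hmult, hC⟩ := ClassX3M.exists_mult_pStar_twist_model (W := W) (p := p) hX
  exact ClassX3M.bsdp_rankZero_of_unitCoeffCert_of_lamEqW hDel98 hDelX hPal hGZK hmod hmodD hW16 hX hr
    hcert
    (fun D g hκ hγ hDt hchar hμg ↦ X3Branch.lamEqW_of_countSucc_of_eval S₀ hΦ
      (fun D' g' hκ' hγ' hDt' hg' hμ' ↦ X3Branch.algebraicCountWMult_degenerate_of_facts h23 hRQ hT40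
        hT41 hLiftE hp2 (ClassX3M.potMult W p hX) V hmult hC S₀ hne hS₀ hS Φ₀ hΦ htriv (hA _ hκ') D' g'
        hκ' hγ' hDt' hg' hμ')
      hn D g hκ hγ hDt hchar hμg)

/-- **Every member of a DEGENERATE class at `3`** (in particular the `μ_3`-line member, whose
rational line is odd): `BSD(E,3)` for `W` isogenous to a degenerate (G-ord, `e = 2`) member `W'` of
analytic rank `0` — Cassels' invariance (`hCassels`, PUBLISHED) ∘ the previous theorem on `W'`.
[cite: MilneADT2006, Thm. I.7.3 and Remark I.7.4] [cite: Delbourgo1998, Prop. 4 (p. 144)]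
[cite: Wuthrich2014, Thm. 16 (p. 397)] [cite: Miller2011LMS, §1] -/
theorem ClassX3Gord.bsdp_three_of_isIsogenous_degenerate_of_facts [Fact (Nat.Prime 3)]
    {W W' : WeierstrassCurve ℚ} [W.IsElliptic] [W.IsGloballyMinimal] [W'.IsElliptic]
    [W'.IsGloballyMinimal]
    (hCassels : bsdRHS_eq_of_isIsogenous)
    (hDelG : Delbourgo1998.prop4_rankZero_constantCoeff_eq_unit_mul_of_potGoodOrd)
    (hDel98 : Delbourgo1998.prop4_rankZero_pow_dvd_constantCoeff)
    (hGZK : rank_eq_analyticRank_of_analyticRank_le_one) (hmod : hasEntireLFunction_rat)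
    (hmodD : nonempty_modularParametrizationData)
    (hW16 : Wuthrich2014.thm16_halfEigenCharIdeal_dvd_cyclotomicPrime)
    (h23 : datumSelmer_nonPrimitive_invariants)
    (hRQ : datumSelmer_divisible_of_finite_torsionBy_of_gr_inertiaInvariants_eq_zero)
    (hGrK : Greenberg1999.imKummer_ge_strictCondition_goodOrdinary)
    (hLiftE : residualEpsilon_surjOn_of_lineEven)
    (hiso : IsIsogenous W W') (hX' : ClassX3Gord W' 3) (hr' : W'.analyticRank = 0)
    (S₀ : Finset (HeightOneSpectrum (𝓞 ℚ))) (hne : S₀.Nonempty)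
    (hS₀ : ∀ v ∈ S₀, (((3 : ℕ) : ℕ) : 𝓞 ℚ) ∉ v.asIdeal)
    (hS : ∀ v : HeightOneSpectrum (𝓞 ℚ), v ∉ S₀ → (((3 : ℕ) : ℕ) : 𝓞 ℚ) ∉ v.asIdeal →
      W'.HasGoodReductionAt v)
    (Φ₀ : AddSubgroup (W'.geomTorsion ((3 : ℕ) : ℤ))) (hΦ : IsRationalLine W' 3 Φ₀)
    (htriv : ∀ (σ : absoluteGaloisGroup ℚ) (P : geomTorsion W' ((3 : ℕ) : ℤ)), P ∈ Φ₀ → σ • P = P)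
    (hA : ∀ κ : ZpExtension ℚ 3, κ.IsCyclotomic →
      Finite (FixedPoints.addSubgroup κ.kerSubgroup (W'.geomPrimaryTorsion 3)))
    {n : ℕ}
    (hcert : ∀ (V : WeierstrassCurve ℚ) [V.IsElliptic] [V.IsGloballyMinimal] (C : VariableChange ℚ),
      C • V.quadraticTwist ((-1) ^ ((3 : ℕ) / 2) * (3 : ℕ) : ℚ) = W' → X3BranchUnitCoeffCertAt V 3 n)
    (hn : ∀ (κ : ZpExtension ℚ 3), κ.IsCyclotomic →
      3 ^ (n + ∑ v ∈ S₀, delta W' 3 v + 1) =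
        Nat.card (residualLineH1 W' 3 κ S₀ Φ₀ hΦ) * Nat.card (residualQuotSelmer W' 3 κ S₀ Φ₀ hΦ)) :
    BSDp W 3 := by
  have hr : W.analyticRank ≤ 1 := by
    rw [analyticRank_eq_of_isIsogenous' hiso, hr']
    exact zero_le_one
  exact N10.bsdp_of_isIsogenous_of_bsdp 3 hCassels hGZK hmod hiso hr
    (ClassX3Gord.bsdp_three_rankZero_degenerate_of_facts hDelG hDel98 hGZK hmod hmodD hW16 h23 hRQ hGrK
      hLiftE hX' hr' S₀ hne hS₀ hS Φ₀ hΦ htriv hA hcert hn)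

/-- **Every member of a DEGENERATE (M) class**: `BSD(E,p)` for `W` isogenous to a degenerate X3♯(M)
member `W'` of analytic rank `0` (Cassels ∘ `ClassX3M.bsdp_rankZero_degenerate_of_facts` on `W'`).
[cite: MilneADT2006, Thm. I.7.3 and Remark I.7.4] [cite: Delbourgo1998, Prop. 4 (p. 144)]
[cite: Wuthrich2014, Thm. 16 (p. 397)] [cite: Miller2011LMS, §1] -/
theorem ClassX3M.bsdp_of_isIsogenous_degenerate_of_facts
    {W W' : WeierstrassCurve ℚ} [W.IsElliptic] [W.IsGloballyMinimal] [W'.IsElliptic]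
    [W'.IsGloballyMinimal]
    (hCassels : bsdRHS_eq_of_isIsogenous)
    (hDel98 : Delbourgo1998.prop4_rankZero_pow_dvd_constantCoeff)
    (hDelX : Delbourgo1998.prop4_rankZero_constantCoeff_eq_unit_mul_of_potMult)
    (hPal : Pal2012.thm32_sqrt_mul_realPeriodRat_twist_eq_of_prime_one_mod_four)
    (hGZK : rank_eq_analyticRank_of_analyticRank_le_one) (hmod : hasEntireLFunction_rat)
    (hmodD : nonempty_modularParametrizationData)
    (hW16 : Wuthrich2014.thm16_halfEigenCharIdeal_dvd_cyclotomicPrime)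
    (h23 : datumSelmer_nonPrimitive_invariants)
    (hRQ : datumSelmer_divisible_of_finite_torsionBy_of_gr_inertiaInvariants_eq_zero)
    (hT40 : Silverman1994_thmV53_tateUniformisation.{0})
    (hT41 : Silverman1994_thmV53_corV54_tateUniformisation.{0})
    (hLiftE : residualEpsilon_surjOn_of_lineEven)
    (hiso : IsIsogenous W W') (hX' : ClassX3M W' p) (hr' : W'.analyticRank = 0)
    (S₀ : Finset (HeightOneSpectrum (𝓞 ℚ))) (hne : S₀.Nonempty)
    (hS₀ : ∀ v ∈ S₀, ((p : ℕ) : 𝓞 ℚ) ∉ v.asIdeal)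
    (hS : ∀ v : HeightOneSpectrum (𝓞 ℚ), v ∉ S₀ → ((p : ℕ) : 𝓞 ℚ) ∉ v.asIdeal →
      W'.HasGoodReductionAt v)
    (Φ₀ : AddSubgroup (W'.geomTorsion (p : ℤ))) (hΦ : IsRationalLine W' p Φ₀)
    (htriv : ∀ (σ : absoluteGaloisGroup ℚ) (P : geomTorsion W' (p : ℤ)), P ∈ Φ₀ → σ • P = P)
    (hA : ∀ κ : ZpExtension ℚ p, κ.IsCyclotomic →
      Finite (FixedPoints.addSubgroup κ.kerSubgroup (W'.geomPrimaryTorsion p)))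
    {n : ℕ}
    (hcert : ∀ (V : WeierstrassCurve ℚ) [V.IsElliptic] [V.IsGloballyMinimal] (C : VariableChange ℚ),
      C • V.quadraticTwist ((-1) ^ (p / 2) * p : ℚ) = W' → X3BranchUnitCoeffCertAt V p n)
    (hn : ∀ (κ : ZpExtension ℚ p), κ.IsCyclotomic →
      p ^ (n + ∑ v ∈ S₀, delta W' p v + 1) =
        Nat.card (residualLineH1 W' p κ S₀ Φ₀ hΦ) * Nat.card (residualQuotSelmer W' p κ S₀ Φ₀ hΦ)) :
    BSDp W p := by
  have hr : W.analyticRank ≤ 1 := by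
    rw [analyticRank_eq_of_isIsogenous' hiso, hr']
    exact zero_le_one
  exact N10.bsdp_of_isIsogenous_of_bsdp p hCassels hGZK hmod hiso hr
    (ClassX3M.bsdp_rankZero_degenerate_of_facts hDel98 hDelX hPal hGZK hmod hmodD hW16 h23 hRQ hT40
      hT41 hLiftE hX' hr' S₀ hne hS₀ hS Φ₀ hΦ htriv hA hcert hn)

end EndStates

end Summit.BirchSwinnertonDyer.Rank1Residual.Additive

end
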